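import Mathlib
import HarnessLib
import Summits.Ventures.LatticeQCDFlow.Exactness.NCMCGeneralSpaceRestartChainReweightedCLT
import Summits.Ventures.LatticeQCDFlow.Exactness.NCMCGeneralSpaceGammaMethodPlugIn
import Summits.Ventures.LatticeQCDFlow.Exactness.NCMCGeneralSpaceGammaMethodStudentizedCLT
import Summits.Ventures.LatticeQCDFlow.Exactness.NCMCGeneralSpaceRestartChainGammaCoverage
import Summits.Ventures.LatticeQCDFlow.Scoring.DeltaMethod

/-!
# The reweighting lane along CORRELATED starts: the printed plug-in Γ-method error bar `R_n ± z √(V̂_n/n) / Ȳ_n` of a reweighted end-point average is asymptotically exact from EVERY initial record law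

HONEST FRAMING: exact (Metropolis-corrected) sampling algorithms for lattice gauge theory;
figures of merit are autocorrelation/cost numbers at stated couplings and volumes; no
continuum-physics claim.

Venture `LatticeQCDFlow` (cell pub-lqcd), topic `Exactness`; FANOUT row 13 (`eng-snf`, GEN-22).
NEW WORK of the cell, not a published result; no definition is introduced; nothing is cited as a
fact.  GEN-22's `NCMCGeneralSpaceRestartChainReweightedCLT` proved
`√n (R_n − μ_f) ⇒ N(0, σ²_c / (Z₁/Z₀)²)` for the self-normalised reweighted average
`R_n = Σ_{i<n} e^{−W_i} f(end_i) / Σ_{i<n} e^{−W_i}` along the restart chain, with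
`c = e^{−W} (f ∘ e − μ_f)` and `σ²_c` its Green–Kubo variance, and stated "NOT CLAIMED: a consistent
estimator of `σ²_c` (the natural plug-in series uses `R_n` in place of `μ_f`)".  THIS FILE supplies
it: the Γ-method statistic `V̂_n = Γ̂_n(0) · 2 τ̂_{n,W_n}` of the PLUG-IN series
`ĉ_i = e^{−W_i} (f(end_i) − R_n)` converges in probability to `σ²_c` (GEN-20's consistency for the
fixed series `c_i` + `NCMCGeneralSpaceGammaMethodPlugIn`: `|ĉ_i − c_i| ≤ e^{B} |R_n − μ_f|`, so
`|V̂_n − V_n| ≤ 32 (C_f + 1) e^{2B} (W_n + 1) |R_n − μ_f| → 0` in probability by the CLT and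
`W_n²/n → 0`), the mean weight `Ȳ_n → Z₁/Z₀` almost surely, and Slutsky's theorem.

## Content (hypotheses of `CrooksPair.tendstoInDistribution_reweighted_restartChain`, plus
## `σ²_c > 0`, windows `W_n → ∞` with `W_n³/n → 0`, `z > 0`)

* `abs_weightedMean_le` — `|Σ w_i f_i / Σ w_i| ≤ C` for positive weights and `|f_i| ≤ C`.
* **`CrooksPair.tendsto_measure_reweighted_mem_gammaInterval_restartChain`** — for EVERY initial
  record law `μ₀`: `P_{μ₀}{ |R_n − μ_f| ≤ z √(V̂_n / n) / Ȳ_n } → gaussianReal 0 1 (Icc (−z) z)`.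

Reading (value-free): the honest error bar of `estimators.reweight` along correlated launches is the
Γ-method error of the plug-in series `e^{−W_i}(f(end_i) − R_n)` divided by the mean weight — the same
recipe as the Jarzynski lane's (`NCMCGeneralSpaceRestartChainGammaCoverage`).  NOT CLAIMED: `σ²_c > 0`
(assumed); unbounded `f` or work; data-driven windows (clip them); rates; anything numerical.
-/

namespace Summit.Ventures.LatticeQCDFlow.Exactness.GeneralNCMC

open MeasureTheory ProbabilityTheory Set Filter Finset
open scoped ENNReal NNReal Topology

/-- A weighted mean with positive weights of values bounded by `C ≥ 0` is bounded by `C`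
(the value at `n = 0` is `0/0 = 0`). -/
theorem abs_weightedMean_le {w f : ℕ → ℝ} {C : ℝ} (hC : 0 ≤ C) (hw : ∀ i, 0 < w i)
    (hf : ∀ i, |f i| ≤ C) (n : ℕ) :
    |(∑ i ∈ range n, w i * f i) / ∑ i ∈ range n, w i| ≤ C := by
  rcases Nat.eq_zero_or_pos n with hn | hn
  · subst hn; simpa using hC
  have hS : 0 < ∑ i ∈ range n, w i :=
    Finset.sum_pos (fun i _ => hw i) (Finset.nonempty_range_iff.2 hn.ne')
  rw [abs_div, abs_of_pos hS, div_le_iff₀ hS]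
  calc |∑ i ∈ range n, w i * f i| ≤ ∑ i ∈ range n, |w i * f i| := abs_sum_le_sum_abs _ _
    _ ≤ ∑ i ∈ range n, C * w i := sum_le_sum fun i _ => by
        rw [abs_mul, abs_of_pos (hw i), mul_comm]
        exact mul_le_mul_of_nonneg_right (hf i) (hw i).le
    _ = C * ∑ i ∈ range n, w i := by rw [Finset.mul_sum]

/-- `√n / (W_n + 1) → ∞` when `W_n → ∞` and `W_n³ / n → 0` (local copy of the lemma of
`NCMCGeneralSpaceBarRestartChainsGammaCoverage`, kept private so that this file does not wait for
that module's build). -/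
private theorem tendsto_sqrt_div_window_atTop' {Wn : ℕ → ℕ} (hW : Tendsto Wn atTop atTop)
    (hW3 : Tendsto (fun n => (Wn n : ℝ) ^ 3 / n) atTop (𝓝 0)) :
    Tendsto (fun n : ℕ => Real.sqrt n / ((Wn n : ℝ) + 1)) atTop atTop := by
  -- `(W_n + 1)² / n → 0`
  have h1 : Tendsto (fun n : ℕ => ((Wn n : ℝ) + 1) ^ 2 / n) atTop (𝓝 0) := by
    have h4 : Tendsto (fun n : ℕ => 4 * ((Wn n : ℝ) ^ 3 / n)) atTop (𝓝 0) := by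
      simpa using hW3.const_mul (4 : ℝ)
    have hev : ∀ᶠ n : ℕ in atTop, ((Wn n : ℝ) + 1) ^ 2 / n ≤ 4 * ((Wn n : ℝ) ^ 3 / n) := by
      filter_upwards [hW.eventually_ge_atTop 1] with n hn
      have hw : (1 : ℝ) ≤ Wn n := by exact_mod_cast hn
      rw [← mul_div_assoc]
      refine div_le_div_of_nonneg_right ?_ (Nat.cast_nonneg n)
      nlinarith [hw, sq_nonneg ((Wn n : ℝ) - 1)]
    exact tendsto_of_tendsto_of_tendsto_of_le_of_le' tendsto_const_nhds h4
      (Eventually.of_forall fun n => by positivity) hev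
  have h2 : ∀ᶠ n : ℕ in atTop, ((Wn n : ℝ) + 1) ^ 2 / n ∈ Ioi (0 : ℝ) := by
    filter_upwards [Filter.eventually_gt_atTop 0] with n hn
    have hn' : (0 : ℝ) < n := by exact_mod_cast hn
    exact div_pos (by positivity) hn'
  have h3 : Tendsto (fun n : ℕ => (((Wn n : ℝ) + 1) ^ 2 / n)⁻¹) atTop atTop :=
    (tendsto_nhdsWithin_iff.2 ⟨h1, h2⟩).inv_tendsto_nhdsGT_zero
  refine (Real.tendsto_sqrt_atTop.comp h3).congr' ?_
  filter_upwards [Filter.eventually_gt_atTop 0] with n hn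
  have hw : (0 : ℝ) < (Wn n : ℝ) + 1 := by positivity
  simp only [Function.comp_apply]
  rw [inv_div, Real.sqrt_div' _ (sq_nonneg _), Real.sqrt_sq hw.le]

variable {Ω E : Type*} [MeasurableSpace Ω] [MeasurableSpace E]

namespace CrooksPair

variable {ν₀ ν₁ : Measure Ω} [IsFiniteMeasure ν₀] [IsFiniteMeasure ν₁] {κF κR : Kernel Ω E}
  [IsMarkovKernel κF] [IsMarkovKernel κR] {s e : E → Ω} {W : E → ℝ}

/-- **THE PRINTED PLUG-IN Γ-METHOD INTERVAL OF A REWEIGHTED END-POINT AVERAGE ALONG CORRELATED STARTS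
IS ASYMPTOTICALLY EXACT, FROM EVERY INITIAL RECORD LAW.**  Crooks pair with `Z₀, Z₁ ≠ 0`; `−B ≤ W`;
`|f| ≤ C_f` measurable; `K` Markov, `ν₀`-invariant, `m ≤ K(z, ·)` for all `z` (`m` finite non-zero);
`μ_f = Z₁⁻¹ ∫ f dν₁`; `σ²_c > 0`; windows `W_n → ∞`, `W_n³/n → 0`; `z > 0`.  With
`R_n = Σ e^{−W_i} f(end_i) / Σ e^{−W_i}`, `Ȳ_n = (1/n) Σ e^{−W_i}` and `V̂_n = Γ̂_n(0) · 2 τ̂_{n,W_n}`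
computed on the plug-in series `e^{−W_i} (f(end_i) − R_n)`:
`P_{μ₀}{ |R_n − μ_f| ≤ z √(V̂_n / n) / Ȳ_n } → gaussianReal 0 1 (Icc (−z) z)`. -/
theorem tendsto_measure_reweighted_mem_gammaInterval_restartChain (K : Kernel Ω Ω) [IsMarkovKernel K]
    (h0 : ν₀ univ ≠ 0) (h1 : ν₁ univ ≠ 0) (hK : Kernel.Invariant K ν₀)
    (h : CrooksPair ν₀ ν₁ κF κR s e W) {m : Measure Ω} [IsFiniteMeasure m] (hm0 : m univ ≠ 0)
    (hmin : ∀ z, m ≤ K z) {B : ℝ} (hB : ∀ ω, -B ≤ W ω) {f : Ω → ℝ} (hfm : Measurable f) {Cf : ℝ}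
    (hCf : ∀ y, |f y| ≤ Cf)
    (hσ : 0 < (∫ ω, (Real.exp (-W ω) * (f (e ω) - ((ν₁ univ)⁻¹).toReal * ∫ y, f y ∂ν₁)) ^ 2
          ∂(fwdPathLaw ν₀ κF))
      + 2 * ∑' k, ∫ ω, (Real.exp (-W ω) * (f (e ω) - ((ν₁ univ)⁻¹).toReal * ∫ y, f y ∂ν₁))
        * (Scoring.kop ((κF ∘ₖ K).comap s h.measurable_s))^[k + 1]
            (fun ω => Real.exp (-W ω) * (f (e ω) - ((ν₁ univ)⁻¹).toReal * ∫ y, f y ∂ν₁)) ω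
          ∂(fwdPathLaw ν₀ κF))
    {Wn : ℕ → ℕ} (hW : Tendsto Wn atTop atTop)
    (hW3 : Tendsto (fun n => (Wn n : ℝ) ^ 3 / n) atTop (𝓝 0)) {z : ℝ} (hz : 0 < z)
    (μ₀ : Measure E) [IsProbabilityMeasure μ₀]
    [IsProbabilityMeasure (Kernel.trajMeasure (X := fun _ : ℕ => E) μ₀
        (fun n : ℕ => ((κF ∘ₖ K).comap s h.measurable_s).comap
          (fun hh : (j : ↥(Finset.Iic n)) → E => hh ⟨n, Finset.mem_Iic.2 le_rfl⟩)
          (measurable_pi_apply _)))] :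
    Tendsto (fun n : ℕ => (Kernel.trajMeasure (X := fun _ : ℕ => E) μ₀
        (fun n : ℕ => ((κF ∘ₖ K).comap s h.measurable_s).comap
          (fun hh : (j : ↥(Finset.Iic n)) → E => hh ⟨n, Finset.mem_Iic.2 le_rfl⟩)
          (measurable_pi_apply _)))
        {ω : ℕ → E | |(∑ i ∈ range n, Real.exp (-W (ω i)) * f (e (ω i))) /
              (∑ i ∈ range n, Real.exp (-W (ω i))) - ((ν₁ univ)⁻¹).toReal * ∫ y, f y ∂ν₁|
          ≤ z * Real.sqrt (Scoring.gammaHat (fun i => Real.exp (-W (ω i)) * (f (e (ω i))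
                - (∑ j ∈ range n, Real.exp (-W (ω j)) * f (e (ω j))) / ∑ j ∈ range n, Real.exp (-W (ω j))))
                n 0
              * (2 * Scoring.tauIntWindow (Scoring.rhoHat (fun i => Real.exp (-W (ω i)) * (f (e (ω i))
                - (∑ j ∈ range n, Real.exp (-W (ω j)) * f (e (ω j))) / ∑ j ∈ range n, Real.exp (-W (ω j))))
                n) (Wn n)) / n)
            / ((∑ i ∈ range n, Real.exp (-W (ω i))) / n)})
      atTop (𝓝 (gaussianReal 0 1 (Icc (-z) z))) := by
  set κr := (κF ∘ₖ K).comap s h.measurable_s with hκr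
  set P := Kernel.trajMeasure (X := fun _ : ℕ => E) μ₀
    (fun n : ℕ => κr.comap (fun hh : (j : ↥(Finset.Iic n)) → E => hh ⟨n, Finset.mem_Iic.2 le_rfl⟩)
      (measurable_pi_apply _)) with hP
  haveI := isProbabilityMeasure_fwdPathLaw ν₀ h0 κF
  haveI := isProbabilityMeasure_normalised_bind_kernel κF hm0
  haveI : Nonempty E := nonempty_of_isProbabilityMeasure μ₀
  set θ : ℝ := ((ν₀ univ)⁻¹ * ν₁ univ).toReal with hθdef
  set μf : ℝ := ((ν₁ univ)⁻¹).toReal * ∫ y, f y ∂ν₁ with hμf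
  have hθ : 0 < θ :=
    ENNReal.toReal_pos (mul_ne_zero (ENNReal.inv_ne_zero.2 (measure_ne_top ν₀ univ)) h1)
      (ENNReal.mul_ne_top (ENNReal.inv_ne_top.2 h0) (measure_ne_top ν₁ univ))
  have hCf0 : 0 ≤ Cf := (abs_nonneg _).trans (hCf (s (Classical.choice
    (nonempty_of_isProbabilityMeasure (fwdPathLaw ν₀ κF)))))
  -- the chain: invariance and one-step minorisation (GEN-16 / GEN-18)
  have hinv : Kernel.Invariant κr (fwdPathLaw ν₀ κF) := h.invariant_restartKernel K hK
  have hD := restartKernel_nHit_one_minorised K h hm0 hmin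
  have hε1 : m univ ≤ 1 := by
    haveI := isMarkovKernel_nHit κr 1
    exact eps_le_one_of_minorised hD
  -- the centred numerator observable `c`, bounded, mean zero
  set c : E → ℝ := fun ω => Real.exp (-W ω) * (f (e ω) - μf) with hc
  have hwm : Measurable fun ω => Real.exp (-W ω) := Real.measurable_exp.comp h.measurable_W.neg
  have hcm : Measurable c := hwm.mul ((hfm.comp h.measurable_e).sub measurable_const)
  have hwB : ∀ ω, Real.exp (-W ω) ≤ Real.exp B := fun ω => Real.exp_le_exp.2 (by linarith [hB ω])
  have hμfb : |μf| ≤ Cf := by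
    rw [hμf, abs_mul, ENNReal.toReal_inv, abs_inv, abs_of_nonneg ENNReal.toReal_nonneg]
    rcases eq_or_ne (ν₁ univ).toReal 0 with hz0 | hz0
    · rw [hz0, inv_zero, zero_mul]; exact hCf0
    · rw [inv_mul_le_iff₀ (lt_of_le_of_ne ENNReal.toReal_nonneg (Ne.symm hz0)), ← Real.norm_eq_abs]
      calc ‖∫ y, f y ∂ν₁‖ ≤ Cf * ν₁.real univ :=
            norm_integral_le_of_norm_le_const (Eventually.of_forall fun y => by
              rw [Real.norm_eq_abs]; exact hCf y)
        _ = (ν₁ univ).toReal * Cf := by rw [measureReal_def, mul_comm]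
  have hcb : ∀ ω, |c ω| ≤ 2 * (Cf + 1) * Real.exp B := fun ω => by
    rw [hc]
    dsimp only
    rw [abs_mul, abs_of_pos (Real.exp_pos _)]
    calc Real.exp (-W ω) * |f (e ω) - μf| ≤ Real.exp B * (Cf + Cf) :=
          mul_le_mul (hwB ω) ((abs_sub _ _).trans (add_le_add (hCf _) hμfb)) (abs_nonneg _)
            (Real.exp_pos _).le
      _ ≤ 2 * (Cf + 1) * Real.exp B := by nlinarith [Real.exp_pos B]
  have hc0 : ∫ ω, c ω ∂(fwdPathLaw ν₀ κF) = 0 := by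
    have key := h.integral_exp_neg_work_mul_comp_end (f := fun y => f y - μf)
      (hfm.sub measurable_const).aestronglyMeasurable
    have hint : ∫ y, (f y - μf) ∂ν₁ = ∫ y, f y ∂ν₁ - ν₁.real univ * μf := by
      rw [integral_sub (Scoring.integrable_of_bounded ν₁ hfm hCf) (integrable_const _),
        integral_const, smul_eq_mul]
    rw [hc]
    dsimp only
    rw [key, hint, hμf, measureReal_def]
    simp only [ENNReal.toReal_inv]
    rcases eq_or_ne (ν₁ univ).toReal 0 with hz0 | hz0
    · have : ∫ y, f y ∂ν₁ = 0 := by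
        have hν : ν₁ = 0 := by
          rw [← Measure.measure_univ_eq_zero]
          exact (ENNReal.toReal_eq_zero_iff _).1 hz0 |>.resolve_right (measure_ne_top _ _)
        rw [hν, integral_zero_measure]
      rw [this, hz0]; ring
    · field_simp
      ring
  set σ2 : ℝ := (∫ ω, (Real.exp (-W ω) * (f (e ω) - μf)) ^ 2 ∂(fwdPathLaw ν₀ κF))
      + 2 * ∑' k, ∫ ω, (Real.exp (-W ω) * (f (e ω) - μf))
        * (Scoring.kop κr)^[k + 1] (fun ω => Real.exp (-W ω) * (f (e ω) - μf)) ω ∂(fwdPathLaw ν₀ κF)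
    with hσ2
  -- (1) the CLT (GEN-22), canonical Gaussian variable
  have hU := h.tendstoInDistribution_reweighted_restartChain K h0 h1 hK hm0 hmin hB hfm hCf μ₀
    (P' := gaussianReal 0 (Real.toNNReal (σ2 / θ ^ 2))) (Y := id) HasLaw.id
  -- the estimator and its range
  set Rn : ℕ → (ℕ → E) → ℝ := fun n ω => (∑ i ∈ range n, Real.exp (-W (ω i)) * f (e (ω i))) /
    ∑ i ∈ range n, Real.exp (-W (ω i)) with hRn
  have hRb : ∀ n ω, |Rn n ω| ≤ Cf := fun n ω =>
    abs_weightedMean_le (w := fun i => Real.exp (-W (ω i))) (f := fun i => f (e (ω i))) hCf0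
      (fun i => Real.exp_pos _) (fun i => hCf _) n
  have hRm : ∀ n, Measurable (Rn n) := fun n =>
    (Finset.measurable_sum _ fun i _ => (hwm.comp (measurable_pi_apply i)).mul
      (hfm.comp (h.measurable_e.comp (measurable_pi_apply i)))).div
      (Finset.measurable_sum _ fun i _ => hwm.comp (measurable_pi_apply i))
  -- (2) `(W_n + 1)(R_n − μ_f) → 0` in probability
  have hT : TendstoInMeasure P (fun n ω => ((Wn n : ℝ) + 1) * (Rn n ω - μf)) atTop
      (fun _ => (0 : ℝ)) := by
    have hsc := Scoring.CardConsistency.tendstoInMeasure_of_tendstoInDistribution_scaled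
      (P := P) (X := fun n ω => μf + ((Wn n : ℝ) + 1) * (Rn n ω - μf)) (θ := μf)
      (tendsto_sqrt_div_window_atTop' hW hW3)
      (hU.congr (fun n => Eventually.of_forall fun ω => by
        have hw : ((Wn n : ℝ) + 1) ≠ 0 := by positivity
        show Real.sqrt n * (Rn n ω - μf)
          = Real.sqrt n / ((Wn n : ℝ) + 1) * (μf + ((Wn n : ℝ) + 1) * (Rn n ω - μf) - μf)
        field_simp
        ring) Filter.EventuallyEq.rfl)
    rw [tendstoInMeasure_iff_norm] at hsc ⊢
    intro ε hε
    refine (hsc ε hε).congr fun n => ?_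
    congr 1
    ext ω
    simp only [Set.mem_setOf_eq, add_sub_cancel_left, sub_zero]
  -- (3) the plug-in variance statistic converges in probability to `σ²_c`
  have hcons := chain_gammaWindow_tendstoInMeasure_of_nHit μ₀ (fun z B hB => minorised_setwise hD z hB)
    (pos_iff_ne_zero.2 hm0) hε1 Nat.one_pos hinv hcm hcb hW hW3
  have hA : Scoring.autocov κr (fwdPathLaw ν₀ κF) (fun y => c y - ∫ z, c z ∂(fwdPathLaw ν₀ κF)) 0
      + 2 * ∑' t, Scoring.autocov κr (fwdPathLaw ν₀ κF)
        (fun y => c y - ∫ z, c z ∂(fwdPathLaw ν₀ κF)) (t + 1) = σ2 := by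
    rw [hc0]
    simp only [sub_zero, hσ2, hc]
    unfold Scoring.autocov
    simp only [Function.iterate_zero, id_eq, sq]
  rw [hA] at hcons
  set Vh : ℕ → (ℕ → E) → ℝ := fun n ω =>
    Scoring.gammaHat (fun i => Real.exp (-W (ω i)) * (f (e (ω i)) - Rn n ω)) n 0
      * (2 * Scoring.tauIntWindow (Scoring.rhoHat (fun i => Real.exp (-W (ω i)) * (f (e (ω i)) - Rn n ω)) n)
        (Wn n)) with hVh
  have hVdiff : TendstoInMeasure P (fun n ω => Vh n ω
      - Scoring.gammaHat (fun i => c (ω i)) n 0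
        * (2 * Scoring.tauIntWindow (Scoring.rhoHat (fun i => c (ω i)) n) (Wn n))) atTop
      (fun _ => (0 : ℝ)) := by
    have hKpos : (0 : ℝ) < 32 * (Cf + 1) * Real.exp B * Real.exp B := by positivity
    refine tendstoInMeasure_zero_of_abs_le_mul hT hKpos fun n ω => ?_
    have hδ : 0 ≤ Real.exp B * |Rn n ω - μf| := by positivity
    have hC2 : 0 ≤ 2 * (Cf + 1) * Real.exp B := by positivity
    have hx : ∀ i < n, |Real.exp (-W (ω i)) * (f (e (ω i)) - Rn n ω)| ≤ 2 * (Cf + 1) * Real.exp B := by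
      intro i _
      rw [abs_mul, abs_of_pos (Real.exp_pos _)]
      calc Real.exp (-W (ω i)) * |f (e (ω i)) - Rn n ω| ≤ Real.exp B * (Cf + Cf) :=
            mul_le_mul (hwB _) ((abs_sub _ _).trans (add_le_add (hCf _) (hRb n ω))) (abs_nonneg _)
              (Real.exp_pos _).le
        _ ≤ 2 * (Cf + 1) * Real.exp B := by nlinarith [Real.exp_pos B]
    have hclose : ∀ i < n, |Real.exp (-W (ω i)) * (f (e (ω i)) - Rn n ω) - c (ω i)|
        ≤ Real.exp B * |Rn n ω - μf| := by
      intro i _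
      rw [hc]
      dsimp only
      rw [← mul_sub, show f (e (ω i)) - Rn n ω - (f (e (ω i)) - μf) = -(Rn n ω - μf) by ring, abs_mul,
        abs_of_pos (Real.exp_pos _), abs_neg]
      exact mul_le_mul_of_nonneg_right (hwB _) (abs_nonneg _)
    have hb := abs_gammaWindow_sub_le_of_close hδ hC2 hx (fun i _ => hcb (ω i)) hclose (Wn n)
    rw [hVh]
    refine hb.trans ?_
    rw [abs_mul, abs_of_pos (by positivity : (0 : ℝ) < (Wn n : ℝ) + 1)]
    nlinarith [abs_nonneg (Rn n ω - μf), (Nat.cast_nonneg (Wn n) : (0 : ℝ) ≤ Wn n), Real.exp_pos B,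
      mul_nonneg (mul_nonneg hCf0 (Real.exp_pos B).le) (abs_nonneg (Rn n ω - μf))]
  have hV : TendstoInMeasure P Vh atTop (fun _ => σ2) :=
    tendstoInMeasure_of_sub_tendstoInMeasure_zero hcons hVdiff
  -- (4) the mean weight converges (almost surely, hence in probability) to `θ = Z₁/Z₀`
  have hYm : ∀ n, Measurable fun ω : ℕ → E => (∑ i ∈ range n, Real.exp (-W (ω i))) / n := fun n =>
    (Finset.measurable_sum _ fun i _ => hwm.comp (measurable_pi_apply i)).div_const _
  have hYbar : TendstoInMeasure P (fun n (ω : ℕ → E) => (∑ i ∈ range n, Real.exp (-W (ω i))) / n)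
      atTop (fun _ => θ) :=
    tendstoInMeasure_of_tendsto_ae (fun n => (hYm n).aestronglyMeasurable)
      (h.tendsto_sampleMean_restartChain_anyLaw K h0 hK hm0 hmin μ₀)
  -- (5) Slutsky: `√n (R_n − μ_f) · Ȳ_n ⇒ N(0, σ²_c)`, then the scale `(√V̂_n)⁻¹ → (√σ²_c)⁻¹`
  have hXY := hU.continuous_comp_prodMk_of_tendstoInMeasure_const
    (g := fun p : ℝ × ℝ => p.1 * p.2) (by fun_prop) hYbar (fun n => (hYm n).aemeasurable)
  have hlawθ : HasLaw (fun y : ℝ => id y * θ)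
      (gaussianReal 0 (NNReal.mk (θ ^ 2) (sq_nonneg _) * Real.toNNReal (σ2 / θ ^ 2)))
      (gaussianReal 0 (Real.toNNReal (σ2 / θ ^ 2))) := by
    have hh := gaussianReal_mul_const (HasLaw.id (μ := gaussianReal 0 (Real.toNNReal (σ2 / θ ^ 2)))) θ
    rwa [mul_zero] at hh
  have hci : ∀ n (i : ℕ), Measurable fun ω : ℕ → E =>
      Real.exp (-W (ω i)) * (f (e (ω i)) - Rn n ω) := fun n i =>
    (hwm.comp (measurable_pi_apply i)).mul ((hfm.comp (h.measurable_e.comp (measurable_pi_apply i))).sub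
      (hRm n))
  have hBm : ∀ n, Measurable fun ω : ℕ → E => (Real.sqrt (Vh n ω))⁻¹ := fun n =>
    (measurable_gammaWindow_of (hci n) n (Wn n)).sqrt.inv
  have hBconv : TendstoInMeasure P (fun n ω => (Real.sqrt (Vh n ω))⁻¹) atTop
      (fun _ => (Real.sqrt σ2)⁻¹) :=
    tendstoInMeasure_comp_continuousAt (g := fun v : ℝ => (Real.sqrt v)⁻¹) hV
      (Real.continuous_sqrt.continuousAt.inv₀ (Real.sqrt_pos.2 hσ).ne') hBm
  have key := tendsto_measure_abs_mul_le_of_clt_of_tendstoInMeasure hBm hlawθ hXY hBconv hz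
  have hone : NNReal.mk (((Real.sqrt σ2)⁻¹) ^ 2) (sq_nonneg _)
      * (NNReal.mk (θ ^ 2) (sq_nonneg _) * Real.toNNReal (σ2 / θ ^ 2)) = 1 := by
    apply NNReal.eq
    rw [NNReal.coe_mul, NNReal.coe_mul, NNReal.coe_mk, NNReal.coe_mk,
      Real.coe_toNNReal _ (div_nonneg hσ.le (sq_nonneg _)), NNReal.coe_one, inv_pow,
      Real.sq_sqrt hσ.le]
    field_simp
  rw [hone] at key
  -- (6) the two events coincide off `{V̂_n ≤ 0} ∪ {n = 0}`, whose probability vanishes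
  set Bn : ℕ → Set (ℕ → E) := fun n => {ω | Vh n ω ≤ 0} ∪ {ω | n = 0} with hBdef
  have hBt : Tendsto (fun n => P (Bn n)) atTop (𝓝 0) := by
    have h1' : Tendsto (fun n => P {ω | Vh n ω ≤ 0}) atTop (𝓝 0) := by
      have hcv := hV (ENNReal.ofReal σ2) (by simpa using hσ)
      refine tendsto_of_tendsto_of_tendsto_of_le_of_le tendsto_const_nhds hcv (fun n => bot_le)
        fun n => measure_mono fun ω hω => ?_
      simp only [Set.mem_setOf_eq] at hω ⊢
      rw [edist_dist, Real.dist_eq]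
      refine ENNReal.ofReal_le_ofReal ?_
      rw [abs_sub_comm]
      linarith [le_abs_self (σ2 - Vh n ω)]
    have h2' : Tendsto (fun n : ℕ => P {ω : ℕ → E | n = 0}) atTop (𝓝 0) := by
      refine tendsto_const_nhds.congr' ?_
      filter_upwards [Filter.eventually_gt_atTop 0] with n hn
      rw [show {ω : ℕ → E | n = 0} = ∅ from Set.eq_empty_of_forall_notMem fun ω hω => hn.ne' hω,
        measure_empty]
    have h12 := h1'.add h2'
    rw [add_zero] at h12
    exact tendsto_of_tendsto_of_tendsto_of_le_of_le tendsto_const_nhds h12 (fun n => bot_le)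
      fun n => measure_union_le _ _
  have hYpos : ∀ {n : ℕ}, 0 < n → ∀ ω : ℕ → E, 0 < (∑ i ∈ range n, Real.exp (-W (ω i))) / n := by
    intro n hn ω
    have hn' : (0 : ℝ) < n := by exact_mod_cast hn
    exact div_pos (Finset.sum_pos (fun i _ => Real.exp_pos _) (Finset.nonempty_range_iff.2 hn.ne')) hn'
  refine tendsto_measure_of_eq_off_vanishing hBt (fun n => ?_) key
  ext ω
  simp only [hBdef, Set.mem_inter_iff, Set.mem_compl_iff, Set.mem_union, Set.mem_setOf_eq, not_or,
    not_le]
  constructor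
  · rintro ⟨hle, hVpos, hn⟩
    refine ⟨?_, hVpos, hn⟩
    have hn0 : 0 < n := Nat.pos_of_ne_zero hn
    have hiff := abs_studentizedLog_le_iff hn0 (z := z) (D := Rn n ω - μf) hVpos (hYpos hn0 ω)
    simp only [hVh, hRn, hμf] at hiff
    simp only [hVh, hRn] at hle
    simp only [hμf]
    exact hiff.1 (by simpa [mul_assoc] using hle)
  · rintro ⟨hle, hVpos, hn⟩
    refine ⟨?_, hVpos, hn⟩
    have hn0 : 0 < n := Nat.pos_of_ne_zero hn
    have hiff := abs_studentizedLog_le_iff hn0 (z := z) (D := Rn n ω - μf) hVpos (hYpos hn0 ω)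
    simp only [hVh, hRn, hμf] at hiff
    simp only [hμf] at hle
    simp only [hVh, hRn]
    simpa [mul_assoc] using hiff.2 hle

end CrooksPair

end Summit.Ventures.LatticeQCDFlow.Exactness.GeneralNCMC
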